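import Mathlib
import Summits.NavierStokesRegularity.NavierStokesRegularity.Theorems.TypeIQuarterGateScarEnvelopeTypeISatelliteTowerUniqueContinuation

/-!
# Satellite tower for crux `ScarEnvelopeTypeI` (stmt-NavierStokesRegularity-23843) — ROUND-46 Part E, E13: the past-DSS-free residual NEVER RETURNS EXACTLY — anywhere, at any scale (contrapositive readings of E3′/E3″ for the (ρ)-cell)

Module (26b) of the landing form v1.1 — «E13 only» (ROUND-46.md v1.1 §7 default and referee ref3 g28 F2): E13 `exists_ne_of_noPastDss_slice` /
`exists_ne_of_noPastDss_window` — for a Type-I ancient mild field with no exact past factor `≠ 1`, at EVERY scale `c ≠ 1`, on EVERY open subset of EVERY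
slice (resp. a.e. on every window with interior) the rescaled field differs from the field somewhere: (ρ)-objects are nowhere locally stationary in
similarity variables.  E10–E12 of the plate (`logFactors`, closedness, `typeIAncientMild_exists_logPeriod`, incommensurable factors,
`RootObj.logPeriod_dichotomy`; plate l.432–585) are NOT landed: by the memo's own §0′ ERRATUM they are REDUNDANT with the tree's H4 `stub_prScalingStabilizer` /
ROUND-44 Z3 `pastDss_factors` (E12 is weaker than Z3); they stay in the pub plate.  Module file named for its content (the landing form's placeholder name
`…SatelliteTowerLogPeriod` described the dropped E10–E12).

PROVENANCE: declaration texts VERBATIM from the HOME artefact of the instrument seat nsreg-p3 g29 (cell `pub/ns-regularity-ideate`):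
`round-46/partE46.lean` v1.1 (sha16 `acc8c98b977afd9e`; v1.0 9d6dadbf46a44df3 superseded; ONE section `UniqueContinuation` written against the TREE over the landed
census modules `…SatelliteTowerRootRateDefs/…GallerySeqCompact/…Closure/…EnvelopeStability/…HullCells`; memo `round-46/ROUND-46.md` v1.1 d8300660cdb27bc5),
scored PASS TEXT+LEAN ★★ by referee ref3 g28 (`SCORE-p3-ROUND-46-0828.md` a46a6fe11ecb425f, 22:11:20Z); the author cannot write under `Theorems/`
(`perm.theorems-prover-only`); landed by the prover ns-es-p1 g6 as landing hand of record (director-ns DIRECTOR-NS #237 (3)) following the landing form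
ROUND-46.md v1.1 §7 (26a–c) and ref3 F2 («(26b) = E13 only»), split into ≤ 400-line modules, the artefact's `#guard_msgs … #print axioms` certificates not landed.  `--supports stmt-NavierStokesRegularity-23843 --as helper`.

PROVENANCE OF THE INPUTS (ref3 R45-F3): everything here is unconditional ONLY because these Literature-lineage landings are tree theorems (used BY NAME,
not re-derived): Lemarié-Rieusset 2016 Thm 9.12 local space–time analyticity `lemarieRieusset2016_local_analyticity_holds` (through
`Theorems.analyticOnNhd_uncurry_of_oseenMild`, `IsTypeIAncientMild.analyticOnNhd_slice_univ`); KNSS 2009 §4 bounded Oseen-mild uniqueness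
`oseenMild_bounded_unique` (through `Theorems.ScenarioCensus.FixedAxis.eq_slice_of_eq_slice`); Tsai 1998 Thm 1 (`IsLerayProfile.exists_eq_const_of_bounded`) +
Fabes–Jones–Rivière (`classical_of_smooth_isMildNSSolutionOn_holds`) through `Theorems.stub_selfSimilarRigidity`; KNSS scaling covariance
`IsTypeIAncientMild.nsRescale`; for E14/E15 the R43 CKN-compactness + persistence theorem `abTower_seqCompact`; for E15 Chae–Wolf 2017 Thm 1.3 through the
tree's `chaeWolf_threshold_le_pastDss_factor` (ROUND-44 Z7).

IN-TREE PRIOR ART (memo v1.1 §0′ ERRATUM, disclosed): the ε = 0 content of E4/E6/E7/E10–E12 and the compactness MECHANISM of E14–E16 already exist for the A–B class in routes RecurrentProfiles/SqueezeCycle (`stub_rlNearIdentityDSS`, H4 `stub_prScalingStabilizer` = ROUND-44 Z3 `pastDss_factors`, `stub_gkWindowIncrementRemoval` + `gk_orbitNeverRests`, `smallHullRemoval`, …); the round's own content is the IDENTITY-THEOREM LOCALISATION (arbitrarily small windows / an open piece of one slice) and the STABLE fixed-scale form E16.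

HONEST FRAMING: RIGIDITY AT ε = 0 / qualitative ε-rigidity INSTRUMENT theorems about HYPOTHETICAL Type-I zoom limits (Albritton–Barker objects of the
census of crux `TypeIQuarterGate.ScarEnvelopeTypeI`, item 23843; classes possibly empty).  Movement 0 on anything open: item 23843, route TypeIQuarterGate,
crux 1589 `RecurrentLiouville`, (ρ)/(θ′)/(υ) of ROUND-45, the DSS cells (τ), (κ) at coarse ratio, N0 and Navier–Stokes regularity are all OPEN — NS
regularity is NOT proved here.  No decl of this round is an edge or a proof-of-item (plate audit: orphan 39 / closes 0); η in E14/E15 is INEFFECTIVE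
(compactness + contradiction).  Nearest print (memo §6): Masuda 1967 / LR2016 Thm 9.12 (E2), Chae 2007 Cor 1.3 / Thm 1.5 (E6/E7), Chae 2015 Thm 1.2 and
Chae–Wolf 2017 Thms 1.3/1.5 (E14/E15) — KNOWN mechanisms, disclosed; the content is the junction with the 23843 census.
-/

noncomputable section

-- the summit-side namespace repeats a component by design (single-conjunct summit, D-0017)
set_option linter.dupNamespace false

open MeasureTheory Set Metric Filter Topology Function
open scoped ENNReal NNReal
open Literature.Analysis.FluidPDE

namespace Summit.NavierStokesRegularity.NavierStokesRegularity.Cruxes.ScarEnvelopeTypeI.ZoomDictionary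

section UniqueContinuation

variable {U W : ℝ → (EuclideanSpace ℝ (Fin 3)) → (EuclideanSpace ℝ (Fin 3))}
  {P : ℝ → (EuclideanSpace ℝ (Fin 3)) → ℝ}
  {H : ℝ → (EuclideanSpace ℝ (Fin 3)) → (EuclideanSpace ℝ (Fin 3)) →L[ℝ] (EuclideanSpace ℝ (Fin 3))}
  {M M' : ℝ}

/-! ### E13. The non-DSS residual never returns exactly — anywhere, at any scale -/

/-- ★★ **E13. THE (ρ)-ENEMY'S RETURNS ARE NOWHERE EXACT (slice form).**  A Type-I ancient mild field with NO exact
past factor `> 1` (the non-DSS alternative of E12′ / the residual (ρ) of ROUND-45) has, for every factor `c ≠ 1`,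
every time `t₀ < 0` and every nonempty open `S ⊆ ℝ³`, a point of `S` where `U_c(t₀, ·) ≠ U(t₀, ·)` (E3″ + E4b).
Recurrence (R45 A1) makes the returns ε-CLOSE on windows for a syndetic set of scales; E13 says they are never EXACT
on any window: the open ε-rigidity (υ)/(θ′) is precisely the gap between the two. -/
theorem exists_ne_of_noPastDss_slice (hU : IsTypeIAncientMild M U)
    (hno : ¬ ∃ μ : ℝ, 1 < μ ∧ ∀ t < 0, ∀ x, nsRescale μ U t x = U t x)
    {c : ℝ} (hc : 0 < c) (hc1 : c ≠ 1) {t₀ : ℝ} (ht₀ : t₀ < 0)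
    {S : Set (EuclideanSpace ℝ (Fin 3))} (hS : IsOpen S) (hSne : S.Nonempty) :
    ∃ x ∈ S, nsRescale c U t₀ x ≠ U t₀ x := by
  by_contra hall
  push Not at hall
  have hp := pastDss_of_eqOn_slice hU hc ht₀ hS hSne fun x hx => hall x hx
  rcases hc1.lt_or_gt with hlt | hgt
  · exact hno ⟨c⁻¹, (one_lt_inv₀ hc).2 hlt, pastDss_inv hc hp⟩
  · exact hno ⟨c, hgt, hp⟩

/-- ★★ **E13′. Window form.**  Same, on every nonempty open space–time window inside the slab. -/
theorem exists_ne_of_noPastDss_window (hU : IsTypeIAncientMild M U)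
    (hno : ¬ ∃ μ : ℝ, 1 < μ ∧ ∀ t < 0, ∀ x, nsRescale μ U t x = U t x)
    {c : ℝ} (hc : 0 < c) (hc1 : c ≠ 1) {O : Set (ℝ × (EuclideanSpace ℝ (Fin 3)))} (hO : IsOpen O)
    (hne : O.Nonempty) (hOs : O ⊆ Iio (0 : ℝ) ×ˢ (univ : Set (EuclideanSpace ℝ (Fin 3)))) :
    ∃ z ∈ O, nsRescale c U z.1 z.2 ≠ U z.1 z.2 := by
  by_contra hall
  push Not at hall
  have hp := pastDss_of_eqOn_open hU hc hO hne hOs fun z hz => hall z hz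
  rcases hc1.lt_or_gt with hlt | hgt
  · exact hno ⟨c⁻¹, (one_lt_inv₀ hc).2 hlt, pastDss_inv hc hp⟩
  · exact hno ⟨c, hgt, hp⟩

end UniqueContinuation

end Summit.NavierStokesRegularity.NavierStokesRegularity.Cruxes.ScarEnvelopeTypeI.ZoomDictionary

end
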